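import Literature.MathematicalPhysics.QuantumFieldTheory.Balaban1983to89.B6KLevelCensusIndexV1

/-!
# `Balaban1983to89.B9CarrierBlockMultiplicity` — a carrier block of the k-level V1 domain datum belongs to AT MOST 2(d+1) index bonds (the
# multiplicity `m` of the repaired (3.42) co-reading `B9CoRealizesRel` at the geometry of record)

T. Bałaban, *Propagators and renormalization transformations for lattice gauge theories. II*, Commun. Math. Phys. **96** (1984) 223–250
[`Balaban1984PropagatorsII`], (2.3) p. 224 (*"Λ_j also denotes the set of bonds with at least one end-point in Λ_j"*), (2.45) p. 231.

statement-level skeleton of published theorems with citation tags; proofs where landed; nothing here is a claim about the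
Yang–Mills mass gap

THE POINT.  The repaired (3.42) co-reading `B9CoRealizesRel.CoRealizesRel … Rel …` pays, in its consumer `clause342_of_hasMajorantHom_rel`, the
multiplicity `m` of a `Rel`-class.  At the geometry of record `Rel` is «same carrier block» (`B9CoRealizesRelAtLetters.RelB`): an index bond `c = ⟨j, b⟩`
with carrier block `β c = B^j(y)` is BASED at y (`base c = y`), i.e. `b = ⟨y, μ⟩` (base = source) or `b = ⟨y − e_μ, μ⟩` (base = target) — at most
2(d+1) of them.  THIS FILE proves ★ `card_sameCarrier_le`: `#{c | β c = β c₀} ≤ 2(d+1)` for every index bond `c₀` (an injection into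
`Fin (d+1) × Bool`: the direction, and whether the source is the base end-point), so that `m := 2(d+1)` is a uniform (member-independent) bound.

HONEST SCOPE.  Lattice combinatorics of the tree's own domain datum; nothing of [4] asserted; count-neutral; N06 NOT discharged; nothing continuum,
nothing about the mass gap.  Cell `pub-ymgap` (HUMAN RULING D-0062), Track A node N06 [B9], seat `pub-ymgap-dag-n06-l` (g3), 2026-08-27.
-/

namespace Literature.MathematicalPhysics.QuantumFieldTheory.Balaban1983to89.B9CarrierBlockMultiplicity

open LatticeFieldCalculus
open B5Eq118OneStroke (iterBlockOf)
open B6MultiLevelBoxOperator (N0)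
open B6MultiLevelTorusOperator (TDomains)
open B6Geom246MultiLevelBox (blkOf)
open B6GlobalChartV1 (PV toBox domT)
open B6ScalarChartV1 (blkOf_toBox_eq_iff)
open B6SectAOperatorsV1 (BondIdx)
open B6Ineq2142KLevelV1 (β lvl base baseSite beta_level lev_eq_of_base iterBlockOf_baseSite)
open B6KLevelCensusIndexV1 (KIdx)

variable {d ℓ : ℕ} {m K : ℕ} {hd : 1 ≤ d + 1} {hL : Odd (ℓ + 1) ∧ 1 < ℓ + 1}
variable {Mh k R : ℕ} {P' : Fin (d + 1) → ℕ}

section Count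

variable (hN : ∀ μ, N0 ℓ Mh k P' μ = (PV d ℓ m K hd hL).sitesPerDir 0) (D : TDomains d ℓ Mh k P' R) (hk : k ≤ m + K)

/-- two index bonds with the same carrier block have the same level. [cite: Balaban1984PropagatorsII, (2.45) p.231, bookkeeping] -/
theorem lvl_eq_of_beta_eq (hk1 : 1 ≤ k) {c c' : BondIdx (domT hN D hk)} (h : β hN D hk c = β hN D hk c') :
    lvl hN D hk c = lvl hN D hk c' := by
  rw [← beta_level hN D hk hk1 c, ← beta_level hN D hk hk1 c', h]

/-- two index bonds with the same carrier block and the same level datum have the same base end-point: the carrier block IS the block of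
the base end-point. [cite: Balaban1984PropagatorsII, (2.45) p.231 + (2.3) p.224, bookkeeping] -/
theorem iterBlockOf_baseSite_eq_of_beta_eq (hk1 : 1 ≤ k) {c c' : BondIdx (domT hN D hk)} (h : β hN D hk c = β hN D hk c') :
    iterBlockOf (lvl hN D hk c) (baseSite hN D hk c') = base hN D hk c := by
  have h1 := (blkOf_toBox_eq_iff hN D hk (baseSite hN D hk c) (baseSite hN D hk c')).1 (by
    show β hN D hk c' = β hN D hk c
    exact h.symm)
  rw [lev_eq_of_base hN D hk hk1 c (iterBlockOf_baseSite hN D hk c), iterBlockOf_baseSite hN D hk c] at h1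
  exact h1

/-- ★ **A CARRIER BLOCK BELONGS TO AT MOST 2(d+1) INDEX BONDS**: the index bonds `c` with `β c = β c₀` are among `⟨y, μ⟩` and `⟨y − e_μ, μ⟩`
(y the common base end-point, μ a direction) — an injection `c ↦ (direction, «source is the base»)` into `Fin (d+1) × Bool`.
[cite: Balaban1984PropagatorsII, (2.3) p.224 + (2.45) p.231] -/
theorem card_sameCarrier_le (hk1 : 1 ≤ k) (c₀ : BondIdx (domT hN D hk)) :
    (Finset.univ.filter (fun c : BondIdx (domT hN D hk) => β hN D hk c = β hN D hk c₀)).card ≤ 2 * (d + 1) := by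
  classical
  -- the injection
  let φ : BondIdx (domT hN D hk) → Fin (d + 1) × Bool := fun c =>
    (c.1.2.dir, decide (c.1.2.src ∈ (domT hN D hk).Om (lvl hN D hk c)))
  have hinj : Set.InjOn φ ↑(Finset.univ.filter (fun c : BondIdx (domT hN D hk) => β hN D hk c = β hN D hk c₀)) := by
    intro c hc c' hc' hφ
    simp only [Finset.coe_filter, Finset.mem_univ, true_and, Set.mem_setOf_eq] at hc hc'
    have hβ : β hN D hk c = β hN D hk c' := hc.trans hc'.symm
    -- same level
    have hj : lvl hN D hk c = lvl hN D hk c' := lvl_eq_of_beta_eq hN D hk hk1 hβ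
    -- same base end-point (as j-sites, through the base site of c′)
    have hbase : iterBlockOf (lvl hN D hk c) (baseSite hN D hk c') = base hN D hk c :=
      iterBlockOf_baseSite_eq_of_beta_eq hN D hk hk1 hβ
    -- destructure and substitute the level
    obtain ⟨⟨⟨j, hjk⟩, b⟩, hb⟩ := c
    obtain ⟨⟨⟨j', hjk'⟩, b'⟩, hb'⟩ := c'
    change j = j' at hj
    subst hj
    have hdir : b.dir = b'.dir := congrArg Prod.fst hφ
    have hbool : decide (b.src ∈ (domT hN D hk).Om j) = decide (b'.src ∈ (domT hN D hk).Om j) := congrArg Prod.snd hφ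
    have hbb : base hN D hk ⟨⟨⟨j, hjk⟩, b⟩, hb⟩ = base hN D hk ⟨⟨⟨j, hjk'⟩, b'⟩, hb'⟩ := by
      rw [← hbase]
      exact iterBlockOf_baseSite hN D hk ⟨⟨⟨j, hjk'⟩, b'⟩, hb'⟩
    -- read the base end-points
    have hsrc : b.src = b'.src := by
      by_cases hs : b.src ∈ (domT hN D hk).Om j
      · have hs' : b'.src ∈ (domT hN D hk).Om j := by
          have := hbool; rw [decide_eq_true hs] at this; exact of_decide_eq_true this.symm
        have e1 : base hN D hk ⟨⟨⟨j, hjk⟩, b⟩, hb⟩ = b.src := by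
          show (if b.src ∈ (domT hN D hk).Om j then b.src else b.tgt) = b.src; rw [if_pos hs]
        have e2 : base hN D hk ⟨⟨⟨j, hjk'⟩, b'⟩, hb'⟩ = b'.src := by
          show (if b'.src ∈ (domT hN D hk).Om j then b'.src else b'.tgt) = b'.src; rw [if_pos hs']
        rw [e1, e2] at hbb; exact hbb
      · have hs' : b'.src ∉ (domT hN D hk).Om j := by
          have := hbool; rw [decide_eq_false hs] at this
          exact of_decide_eq_false this.symm
        have e1 : base hN D hk ⟨⟨⟨j, hjk⟩, b⟩, hb⟩ = b.tgt := by
          show (if b.src ∈ (domT hN D hk).Om j then b.src else b.tgt) = b.tgt; rw [if_neg hs]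
        have e2 : base hN D hk ⟨⟨⟨j, hjk'⟩, b'⟩, hb'⟩ = b'.tgt := by
          show (if b'.src ∈ (domT hN D hk).Om j then b'.src else b'.tgt) = b'.tgt; rw [if_neg hs']
        rw [e1, e2] at hbb
        have htgt : b.src.shift b.dir = b'.src.shift b.dir := by
          have : b.tgt = b'.tgt := hbb
          rw [show b.tgt = b.src.shift b.dir from rfl, show b'.tgt = b'.src.shift b'.dir from rfl, ← hdir] at this
          exact this
        exact (shiftEquiv (P := PV d ℓ m K hd hL) b.dir).injective htgt
    have hb_eq : b = b' := by
      cases b; cases b'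
      simp only at hsrc hdir
      subst hsrc; subst hdir; rfl
    subst hb_eq
    rfl
  have hcard := Finset.card_le_card_of_injOn φ (fun c _ => Finset.mem_univ (φ c)) hinj
  have huniv : (Finset.univ : Finset (Fin (d + 1) × Bool)).card = 2 * (d + 1) := by
    rw [Finset.card_univ, Fintype.card_prod, Fintype.card_fin, Fintype.card_bool]; ring
  rw [huniv] at hcard
  exact hcard

end Count

section Census

variable {b₀ b₁ : ℝ}

/-- ★ **at every k-level V1 index**: a carrier block belongs to at most `2(d+1)` index bonds (`KIdx.hk2`: k ≥ 2).
[cite: Balaban1984PropagatorsII, (2.3) p.224 + (2.45) p.231] -/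
theorem card_sameCarrier_le_kIdx (i : KIdx d ℓ hd hL b₀ b₁) (c₀ : BondIdx (domT i.hN i.D i.hk)) :
    (Finset.univ.filter (fun c : BondIdx (domT i.hN i.D i.hk) => β i.hN i.D i.hk c = β i.hN i.D i.hk c₀)).card ≤ 2 * (d + 1) :=
  card_sameCarrier_le i.hN i.D i.hk (le_trans one_le_two i.hk2) c₀

end Census

end Literature.MathematicalPhysics.QuantumFieldTheory.Balaban1983to89.B9CarrierBlockMultiplicity
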